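import Mathlib
import Literature.Probability.LatticeModels.DobrushinInterfaceExistence
import Summits.CriticalPhenomena.CardyFormulaZ2.Theorems.CardyComplexConeDefs
import Summits.CriticalPhenomena.CardyFormulaZ2.Theorems.CardyComplexConeMarkovBlockPresentationCoherence

/-!
# Markov block presentation + uniform cone condition ⇒ `EdgeCoherence` (the glue, typed)

Helper file for item stmt-CriticalPhenomena-8880 (`MarkovBlockPresentation`, route CardyComplexCone of
`CriticalPhenomena/CardyFormulaZ2`; informal, no Lean signature). The route's two-layer plan foresees
`EdgeCoherence ⇐ MarkovBlockPresentation → UniformConeCondition → EdgeCoherence`, "glue =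
ComplexConeContraction iterated over the blocks around `z` … and reading the contracted direction on the
four corner test functions". This file proves that glue against the crux
`Summit.CriticalPhenomena.CardyFormulaZ2.Theses.CardyComplexCone.EdgeCoherence` VERBATIM, with the two
informal mechanism items entering as explicitly typed HYPOTHESES (`edgeCoherence_of_blockPresentation`):

* data: ONE inner-indexed family of block kernels `B k : Matrix (α k) (α (k+1)) ℂ` over nonempty finite
  pattern types (level `0` innermost), shared by all domains / arcs / points; real nonnegative nonzero
  corner test functions `φ o : α 0 → ℝ`; for every discrete Dobrushin datum `E` and vertex `v` a depth
  `depth E v` and a block trajectory `traj E v : (k : ℕ) → α k → ℂ`;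
* `hB` — Dubois' four-pattern condition with UNIFORM `(θ, σ)` for every block, in the exact shape of the
  engine `ComplexConeContraction` (what a typed `UniformConeCondition` should say);
* `hpres`, `hdepth` — the PRESENTATION (what a typed `MarkovBlockPresentation` should say, family form):
  along every discretisation family `Λ` of a Dobrushin domain, eventually in `δ` and for every corner
  `(v,f)` over a compact `K ⊆ D`, `traj (Λ δ) v` is a trajectory of the chain from an outer datum in
  `ℂ₊ ∖ {0}` at level `depth (Λ δ) v` down to level `0`, the corner observable
  (`cornerObs`, verbatim the crux integrand) is its read-out against `φ (f − v)` — EXACTLY in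
  `edgeCoherence_of_blockPresentation`, UP TO `η δ^{1/3}` for every `η > 0` eventually (an `o(δ^{1/3})`
  presentation error, e.g. from binned / approximately Markov patterns) in
  `edgeCoherence_of_approxBlockPresentation` — and the depth tends to infinity uniformly on compacts;
* the engine `ComplexConeContraction` (item stmt-8789) and an a-priori size bound `‖E_δ‖ ≤ C' δ^{1/3}`
  on compacts, eventually (`hbound`; it converts the PROJECTIVE rate of `universal_direction_fintype`
  into the `ε δ^{1/3}` form of the crux) — clause (i) of the crux `EdgePrecompact`, which supplies it in
  the corollary `edgeCoherence_of_blockPresentation_of_edgePrecompact`.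

The universal class vector is `u o = U (φ o)`, `U` the functional of `universal_direction_fintype`
(file …Coherence). Nothing here asserts that such a presentation exists for bond percolation — that is
part (i) of the item, to be typed over `Literature/Probability/Percolation/TwistedArmBlockKernel.lean`
(whose kernel is, as landed, indexed by the domain and stated for canonical data; the hypotheses above
record the `D`-free, family-form shape the mechanism needs).
-/

namespace Summit.CriticalPhenomena.CardyFormulaZ2.Theorems.MarkovBlockPresentation

open scoped ComplexConjugate Topology
open Filter Matrix Literature.Dynamics.Contraction
open Literature.Probability.LatticeModels
open Literature.Probability.RandomPlanarGeometry (DobrushinDomain)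
open Summit.CriticalPhenomena.CardyFormulaZ2.Theses.CardyComplexCone (ComplexConeContraction EdgeCoherence
  EdgePrecompact)
open Summit.CriticalPhenomena.CardyFormulaZ2.Cruxes.EdgePrecompact.QkzStripBoundaryArm (cornerObs)

section Glue

/-- Offsets of corners: `IsCorner v f` gives `IsCorner 0 (f - v)` (the class of the corner). -/
theorem isCorner_zero_sub {v f : Site 2} (h : IsCorner v f) : IsCorner 0 (f - v) := by
  intro i
  simp only [Pi.zero_apply, Pi.sub_apply]
  rcases h i with h | h <;> omega

/-- A function on offsets is bounded on the four corner classes `{0, −e₀, −e₁, −e₀−e₁}` by the sum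
of its four norms there. -/
theorem norm_le_cornerSum (u : Site 2 → ℂ) {o : Site 2} (ho : IsCorner 0 o) :
    ‖u o‖ ≤ ‖u 0‖ + ‖u (0 + -(Pi.single 0 1 : Site 2))‖ + ‖u (0 + -(Pi.single 1 1 : Site 2))‖ +
      ‖u (0 + -(Pi.single 0 1 : Site 2) + -(Pi.single 1 1 : Site 2))‖ := by
  have h0 := norm_nonneg (u 0)
  have h1 := norm_nonneg (u (0 + -(Pi.single 0 1 : Site 2)))
  have h2 := norm_nonneg (u (0 + -(Pi.single 1 1 : Site 2)))
  have h3 := norm_nonneg (u (0 + -(Pi.single 0 1 : Site 2) + -(Pi.single 1 1 : Site 2)))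
  rcases (isCorner_iff' 0 o).1 ho with rfl | rfl | rfl | rfl <;> linarith

/-- Elementary bookkeeping for the glue: `a (E − R) − b (E' − R') + (a R − b R')` controls
`a E − b E'`. -/
theorem norm_coherence_decomp (a b E E' R R' : ℂ) :
    ‖a * E - b * E'‖ ≤ ‖a‖ * ‖E - R‖ + ‖b‖ * ‖E' - R'‖ + ‖a * R - b * R'‖ := by
  have h : a * E - b * E' = a * (E - R) - b * (E' - R') + (a * R - b * R') := by ring
  rw [h]
  calc ‖a * (E - R) - b * (E' - R') + (a * R - b * R')‖
      ≤ ‖a * (E - R) - b * (E' - R')‖ + ‖a * R - b * R'‖ := norm_add_le _ _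
    _ ≤ ‖a * (E - R)‖ + ‖b * (E' - R')‖ + ‖a * R - b * R'‖ := by
        gcongr; exact norm_sub_le _ _
    _ = ‖a‖ * ‖E - R‖ + ‖b‖ * ‖E' - R'‖ + ‖a * R - b * R'‖ := by rw [norm_mul, norm_mul]

variable {θ σ : ℝ} {α : ℕ → Type*} [∀ k, Fintype (α k)] {B : (k : ℕ) → Matrix (α k) (α (k + 1)) ℂ}

/-- **Approximate Markov block presentation + uniform cone condition ⇒ `EdgeCoherence`** (the item's
part (ii), assembled against the crux verbatim, with the presentation allowed an `o(δ^{1/3})` error).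
Data: block kernels `B k : Matrix (α k) (α (k+1)) ℂ` over nonempty finite pattern types, level `0`
innermost (ONE family for all domains, arcs and points); real nonnegative nonzero corner test
functions `φ o : α 0 → ℝ` for the corner classes `o`; for every discrete Dobrushin datum `E` and vertex
`v` a depth `depth E v : ℕ` and a block trajectory `traj E v : (k : ℕ) → α k → ℂ`. Hypotheses: Dubois'
condition with uniform `(θ, σ)` for every block (the shape of `UniformConeCondition`); the engine
`ComplexConeContraction`; the PRESENTATION `hpres` — along every discretisation family of a Dobrushin
domain, on every compact `K ⊆ D` and for every `η > 0`, eventually in `δ`, for every corner `(v, f)`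
with `δv ∈ K`: `traj (Λ δ) v` is a trajectory of the chain down to level `0` from an outer datum in
`ℂ₊ ∖ {0}` at level `depth (Λ δ) v`, and the corner observable (`cornerObs`, verbatim the crux
integrand) is its read-out against `φ (f − v)` UP TO `η δ^{1/3}`:
`‖E_δ(v,f) − ∑ a, φ (f−v) a · traj (Λ δ) v 0 a‖ ≤ η δ^{1/3}`; `hdepth` — the depth tends to infinity
uniformly on compacts; `hbound` — the a-priori size bound `‖E_δ‖ ≤ C' δ^{1/3}` on compacts,
eventually (clause (i) of the crux `EdgePrecompact`). Conclusion: `EdgeCoherence`, with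
`u o = U (φ o)`, `U` the universal functional of `universal_direction_fintype`. -/
theorem edgeCoherence_of_approxBlockPresentation (hne : ∀ k, Nonempty (α k))
    (φ : Site 2 → α 0 → ℝ) (depth : DiscreteDobrushin → Site 2 → ℕ)
    (traj : DiscreteDobrushin → Site 2 → (k : ℕ) → α k → ℂ)
    (hθ0 : 0 < θ) (hθ1 : θ < 1) (hσ : 1 ≤ σ)
    (hB : ∀ k a b p q, θ⁻¹ * ‖B k a p * B k b q - B k a q * B k b p‖ <
        (star (B k a p) * B k b q + star (B k a q) * B k b p).re ∧
      ‖B k a p * B k b q‖ ≤ σ ^ 2 * ‖B k a q * B k b p‖)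
    (hCCC : ComplexConeContraction)
    (hφ : ∀ o, IsCorner 0 o → (∀ a, 0 ≤ φ o a) ∧ φ o ≠ 0)
    (hpres : ∀ (D : DobrushinDomain) (Λ : ℝ → DiscreteDobrushin), (∀ δ, (Λ δ).Ω = D.carrier) →
      (∀ δ, (Λ δ).δ = δ) → (∀ᶠ δ in 𝓝[>] (0:ℝ), (Λ δ).IsZdAdmissible) →
      ∀ K : Set ℂ, IsCompact K → K ⊆ D.carrier → ∀ η > (0:ℝ), ∀ᶠ δ in 𝓝[>] (0:ℝ), ∀ v f : Site 2,
        IsCorner v f → meshPoint δ v ∈ K →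
        (∀ k < depth (Λ δ) v, traj (Λ δ) v k = B k *ᵥ traj (Λ δ) v (k + 1)) ∧
        (∀ a a', 0 ≤ (traj (Λ δ) v (depth (Λ δ) v) a * star (traj (Λ δ) v (depth (Λ δ) v) a')).re) ∧
        traj (Λ δ) v (depth (Λ δ) v) ≠ 0 ∧
        ‖cornerObs (Λ δ) δ v f - ∑ a, (φ (f - v) a : ℂ) * traj (Λ δ) v 0 a‖ ≤ η * δ ^ ((1:ℝ) / 3))
    (hdepth : ∀ (D : DobrushinDomain) (Λ : ℝ → DiscreteDobrushin), (∀ δ, (Λ δ).Ω = D.carrier) →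
      (∀ δ, (Λ δ).δ = δ) → (∀ᶠ δ in 𝓝[>] (0:ℝ), (Λ δ).IsZdAdmissible) →
      ∀ K : Set ℂ, IsCompact K → K ⊆ D.carrier → ∀ N : ℕ, ∀ᶠ δ in 𝓝[>] (0:ℝ), ∀ v : Site 2,
        meshPoint δ v ∈ K → N ≤ depth (Λ δ) v)
    (hbound : ∀ (D : DobrushinDomain) (Λ : ℝ → DiscreteDobrushin), (∀ δ, (Λ δ).Ω = D.carrier) →
      (∀ δ, (Λ δ).δ = δ) → (∀ᶠ δ in 𝓝[>] (0:ℝ), (Λ δ).IsZdAdmissible) →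
      ∀ K : Set ℂ, IsCompact K → K ⊆ D.carrier → ∃ C' : ℝ, ∀ᶠ δ in 𝓝[>] (0:ℝ), ∀ v f : Site 2,
        IsCorner v f → meshPoint δ v ∈ K → ‖cornerObs (Λ δ) δ v f‖ ≤ C' * δ ^ ((1:ℝ) / 3)) :
    EdgeCoherence := by
  obtain ⟨U, C, r, hC, hr0, hr1, hU0, hmain⟩ := universal_direction_fintype hCCC hθ0 hθ1 hσ hne hB
  -- the corner test functions as complex test vectors
  have hφc : ∀ o, IsCorner 0 o → ∀ a a', 0 ≤ ((φ o a : ℂ) * star (φ o a' : ℂ)).re :=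
    fun o ho => ofReal_star_re_nonneg (hφ o ho).1
  have hφ0 : ∀ o, IsCorner 0 o → (fun a => (φ o a : ℂ)) ≠ 0 := fun o ho => ofReal_ne_zero (hφ o ho).2
  -- the universal class vector
  let u : Site 2 → ℂ := fun o => U (fun a => (φ o a : ℂ))
  have hu0 : ∀ o, IsCorner 0 o → u o ≠ 0 := fun o ho => hU0 _ (hφc o ho) (hφ0 o ho)
  refine ⟨u, ⟨0, isCorner_self 0, hu0 0 (isCorner_self 0)⟩, ?_⟩
  intro D Λ hΩ hmesh hadm E K hK hKD ε hε
  -- a bound for `‖u‖` on the four classes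
  set M : ℝ := ‖u 0‖ + ‖u (0 + -(Pi.single 0 1 : Site 2))‖ + ‖u (0 + -(Pi.single 1 1 : Site 2))‖ +
      ‖u (0 + -(Pi.single 0 1 : Site 2) + -(Pi.single 1 1 : Site 2))‖ with hM
  have hM0 : 0 ≤ M := by positivity
  have huM : ∀ o, IsCorner 0 o → ‖u o‖ ≤ M := fun o ho => norm_le_cornerSum u ho
  -- the a-priori size bound
  obtain ⟨C', hC'⟩ := hbound D Λ hΩ hmesh hadm K hK hKD
  set C'' : ℝ := max C' 1 with hC''
  have hC''0 : 0 ≤ C'' := le_trans zero_le_one (le_max_right _ _)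
  -- the presentation error `η` with `2 M η ≤ ε / 2`, `η ≤ 1`
  set η : ℝ := min 1 (ε / (4 * (M + 1))) with hη
  have hη0 : 0 < η := lt_min zero_lt_one (by positivity)
  have hη1 : η ≤ 1 := min_le_left _ _
  have hηε : 2 * M * η ≤ ε / 2 := by
    have h1 : η ≤ ε / (4 * (M + 1)) := min_le_right _ _
    have h2 : 2 * M * η ≤ 2 * M * (ε / (4 * (M + 1))) := by gcongr
    have hM1 : 0 < 4 * (M + 1) := by positivity
    have h4 : 2 * M / (4 * (M + 1)) ≤ 1 / 2 := by
      rw [div_le_iff₀ hM1]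
      linarith
    have h3 : 2 * M * (ε / (4 * (M + 1))) ≤ ε / 2 := by
      calc 2 * M * (ε / (4 * (M + 1))) = 2 * M / (4 * (M + 1)) * ε := by ring
        _ ≤ 1 / 2 * ε := by gcongr
        _ = ε / 2 := by ring
    linarith
  -- choose the depth `N` with `C M (C'' + 1) r^N ≤ ε / 2`
  have hsmall : Tendsto (fun N : ℕ => C * M * (C'' + 1) * r ^ N) atTop (𝓝 0) := by
    have h := (tendsto_pow_atTop_nhds_zero_of_lt_one hr0 hr1).const_mul (C * M * (C'' + 1))
    simpa using h
  obtain ⟨N₀, hN₀⟩ :=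
    (hsmall.eventually (eventually_le_nhds (half_pos hε))).exists_forall_of_atTop
  set N : ℕ := max N₀ 1 with hN
  have hN1 : 1 ≤ N := le_max_right _ _
  have hNε : C * M * (C'' + 1) * r ^ N ≤ ε / 2 := hN₀ N (le_max_left _ _)
  -- eventually in δ: presentation up to `η δ^{1/3}`, depth ≥ N, size bound, `δ > 0`
  filter_upwards [hpres D Λ hΩ hmesh hadm K hK hKD η hη0, hdepth D Λ hΩ hmesh hadm K hK hKD N, hC',
    self_mem_nhdsWithin] with δ hδp hδd hδb hδ0
  intro v f f' hf hf' hvK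
  obtain ⟨htr, hcone, hnz, hEf⟩ := hδp v f hf hvK
  obtain ⟨-, -, -, hEf'⟩ := hδp v f' hf' hvK
  have hKd : N ≤ depth (Λ δ) v := hδd v hvK
  have ho : IsCorner 0 (f - v) := isCorner_zero_sub hf
  have ho' : IsCorner 0 (f' - v) := isCorner_zero_sub hf'
  -- the abstract coherence bound at depth `depth (Λ δ) v ≥ N ≥ 1`
  have key := hmain (depth (Λ δ) v) (le_trans hN1 hKd) (traj (Λ δ) v) htr hcone hnz
    (fun a => (φ (f - v) a : ℂ)) (fun a => (φ (f' - v) a : ℂ)) (hφc _ ho) (hφ0 _ ho) (hφc _ ho')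
    (hφ0 _ ho')
  -- the corner observable is the `E` of the crux
  have hE : ∀ g : Site 2, E δ v g = cornerObs (Λ δ) δ v g := fun _ => rfl
  rw [hE f, hE f']
  set s : ℝ := δ ^ ((1:ℝ) / 3) with hs
  have hs0 : 0 < s := Real.rpow_pos_of_pos hδ0 _
  set Rf : ℂ := ∑ a, (φ (f - v) a : ℂ) * traj (Λ δ) v 0 a with hRf
  set Rf' : ℂ := ∑ a, (φ (f' - v) a : ℂ) * traj (Λ δ) v 0 a with hRf'
  -- sizes
  have hrK : r ^ depth (Λ δ) v ≤ r ^ N := pow_le_pow_of_le_one hr0 hr1.le hKd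
  have hEb : ‖cornerObs (Λ δ) δ v f‖ ≤ C'' * s :=
    (hδb v f hf hvK).trans (by gcongr; exact le_max_left _ _)
  have hRb : ‖Rf‖ ≤ (C'' + η) * s := by
    calc ‖Rf‖ = ‖cornerObs (Λ δ) δ v f - (cornerObs (Λ δ) δ v f - Rf)‖ := by rw [sub_sub_cancel]
      _ ≤ ‖cornerObs (Λ δ) δ v f‖ + ‖cornerObs (Λ δ) δ v f - Rf‖ := norm_sub_le _ _
      _ ≤ C'' * s + η * s := add_le_add hEb hEf
      _ = (C'' + η) * s := by ring
  have hkey' : ‖u (f' - v) * Rf - u (f - v) * Rf'‖ ≤ C * r ^ N * (M * ((C'' + η) * s)) := by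
    calc ‖u (f' - v) * Rf - u (f - v) * Rf'‖
        ≤ C * r ^ depth (Λ δ) v * (‖u (f' - v)‖ * ‖Rf‖) := key
      _ ≤ C * r ^ N * (M * ((C'' + η) * s)) := by gcongr; exact huM _ ho'
  calc ‖u (f' - v) * cornerObs (Λ δ) δ v f - u (f - v) * cornerObs (Λ δ) δ v f'‖
      ≤ ‖u (f' - v)‖ * ‖cornerObs (Λ δ) δ v f - Rf‖ + ‖u (f - v)‖ * ‖cornerObs (Λ δ) δ v f' - Rf'‖ +
          ‖u (f' - v) * Rf - u (f - v) * Rf'‖ := norm_coherence_decomp _ _ _ _ _ _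
    _ ≤ M * (η * s) + M * (η * s) + C * r ^ N * (M * ((C'' + η) * s)) := by
        gcongr
        · exact huM _ ho'
        · exact huM _ ho
    _ = (2 * M * η + C * M * (C'' + η) * r ^ N) * s := by ring
    _ ≤ (ε / 2 + C * M * (C'' + 1) * r ^ N) * s := by
        gcongr
    _ ≤ (ε / 2 + ε / 2) * s := by gcongr
    _ = ε * s := by ring

/-- **Exact Markov block presentation + uniform cone condition ⇒ `EdgeCoherence`**: the case of an
EXACT presentation `E_δ(v,f) = ∑ a, φ (f−v) a · traj (Λ δ) v 0 a` (as the informal item states it),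
eventually in `δ` over every compact; otherwise as `edgeCoherence_of_approxBlockPresentation`. -/
theorem edgeCoherence_of_blockPresentation (hne : ∀ k, Nonempty (α k))
    (φ : Site 2 → α 0 → ℝ) (depth : DiscreteDobrushin → Site 2 → ℕ)
    (traj : DiscreteDobrushin → Site 2 → (k : ℕ) → α k → ℂ)
    (hθ0 : 0 < θ) (hθ1 : θ < 1) (hσ : 1 ≤ σ)
    (hB : ∀ k a b p q, θ⁻¹ * ‖B k a p * B k b q - B k a q * B k b p‖ <
        (star (B k a p) * B k b q + star (B k a q) * B k b p).re ∧
      ‖B k a p * B k b q‖ ≤ σ ^ 2 * ‖B k a q * B k b p‖)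
    (hCCC : ComplexConeContraction)
    (hφ : ∀ o, IsCorner 0 o → (∀ a, 0 ≤ φ o a) ∧ φ o ≠ 0)
    (hpres : ∀ (D : DobrushinDomain) (Λ : ℝ → DiscreteDobrushin), (∀ δ, (Λ δ).Ω = D.carrier) →
      (∀ δ, (Λ δ).δ = δ) → (∀ᶠ δ in 𝓝[>] (0:ℝ), (Λ δ).IsZdAdmissible) →
      ∀ K : Set ℂ, IsCompact K → K ⊆ D.carrier → ∀ᶠ δ in 𝓝[>] (0:ℝ), ∀ v f : Site 2, IsCorner v f →
        meshPoint δ v ∈ K →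
        (∀ k < depth (Λ δ) v, traj (Λ δ) v k = B k *ᵥ traj (Λ δ) v (k + 1)) ∧
        (∀ a a', 0 ≤ (traj (Λ δ) v (depth (Λ δ) v) a * star (traj (Λ δ) v (depth (Λ δ) v) a')).re) ∧
        traj (Λ δ) v (depth (Λ δ) v) ≠ 0 ∧
        cornerObs (Λ δ) δ v f = ∑ a, (φ (f - v) a : ℂ) * traj (Λ δ) v 0 a)
    (hdepth : ∀ (D : DobrushinDomain) (Λ : ℝ → DiscreteDobrushin), (∀ δ, (Λ δ).Ω = D.carrier) →
      (∀ δ, (Λ δ).δ = δ) → (∀ᶠ δ in 𝓝[>] (0:ℝ), (Λ δ).IsZdAdmissible) →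
      ∀ K : Set ℂ, IsCompact K → K ⊆ D.carrier → ∀ N : ℕ, ∀ᶠ δ in 𝓝[>] (0:ℝ), ∀ v : Site 2,
        meshPoint δ v ∈ K → N ≤ depth (Λ δ) v)
    (hbound : ∀ (D : DobrushinDomain) (Λ : ℝ → DiscreteDobrushin), (∀ δ, (Λ δ).Ω = D.carrier) →
      (∀ δ, (Λ δ).δ = δ) → (∀ᶠ δ in 𝓝[>] (0:ℝ), (Λ δ).IsZdAdmissible) →
      ∀ K : Set ℂ, IsCompact K → K ⊆ D.carrier → ∃ C' : ℝ, ∀ᶠ δ in 𝓝[>] (0:ℝ), ∀ v f : Site 2,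
        IsCorner v f → meshPoint δ v ∈ K → ‖cornerObs (Λ δ) δ v f‖ ≤ C' * δ ^ ((1:ℝ) / 3)) :
    EdgeCoherence := by
  refine edgeCoherence_of_approxBlockPresentation hne φ depth traj hθ0 hθ1 hσ hB hCCC hφ ?_ hdepth hbound
  intro D Λ hΩ hmesh hadm K hK hKD η hη
  filter_upwards [hpres D Λ hΩ hmesh hadm K hK hKD, self_mem_nhdsWithin] with δ hδ hδ0
  intro v f hf hvK
  obtain ⟨htr, hcone, hnz, hEf⟩ := hδ v f hf hvK
  refine ⟨htr, hcone, hnz, ?_⟩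
  rw [hEf, sub_self, norm_zero]
  exact mul_nonneg hη.le (Real.rpow_nonneg (le_of_lt hδ0) _)

/-- The same glue with the crux `EdgePrecompact` supplying the size bound (its clause (i)):
exact block presentation + uniform cone condition + `ComplexConeContraction` + `EdgePrecompact` ⇒
`EdgeCoherence`. -/
theorem edgeCoherence_of_blockPresentation_of_edgePrecompact (hne : ∀ k, Nonempty (α k))
    (φ : Site 2 → α 0 → ℝ) (depth : DiscreteDobrushin → Site 2 → ℕ)
    (traj : DiscreteDobrushin → Site 2 → (k : ℕ) → α k → ℂ)
    (hθ0 : 0 < θ) (hθ1 : θ < 1) (hσ : 1 ≤ σ)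
    (hB : ∀ k a b p q, θ⁻¹ * ‖B k a p * B k b q - B k a q * B k b p‖ <
        (star (B k a p) * B k b q + star (B k a q) * B k b p).re ∧
      ‖B k a p * B k b q‖ ≤ σ ^ 2 * ‖B k a q * B k b p‖)
    (hCCC : ComplexConeContraction)
    (hφ : ∀ o, IsCorner 0 o → (∀ a, 0 ≤ φ o a) ∧ φ o ≠ 0)
    (hpres : ∀ (D : DobrushinDomain) (Λ : ℝ → DiscreteDobrushin), (∀ δ, (Λ δ).Ω = D.carrier) →
      (∀ δ, (Λ δ).δ = δ) → (∀ᶠ δ in 𝓝[>] (0:ℝ), (Λ δ).IsZdAdmissible) →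
      ∀ K : Set ℂ, IsCompact K → K ⊆ D.carrier → ∀ᶠ δ in 𝓝[>] (0:ℝ), ∀ v f : Site 2, IsCorner v f →
        meshPoint δ v ∈ K →
        (∀ k < depth (Λ δ) v, traj (Λ δ) v k = B k *ᵥ traj (Λ δ) v (k + 1)) ∧
        (∀ a a', 0 ≤ (traj (Λ δ) v (depth (Λ δ) v) a * star (traj (Λ δ) v (depth (Λ δ) v) a')).re) ∧
        traj (Λ δ) v (depth (Λ δ) v) ≠ 0 ∧
        cornerObs (Λ δ) δ v f = ∑ a, (φ (f - v) a : ℂ) * traj (Λ δ) v 0 a)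
    (hdepth : ∀ (D : DobrushinDomain) (Λ : ℝ → DiscreteDobrushin), (∀ δ, (Λ δ).Ω = D.carrier) →
      (∀ δ, (Λ δ).δ = δ) → (∀ᶠ δ in 𝓝[>] (0:ℝ), (Λ δ).IsZdAdmissible) →
      ∀ K : Set ℂ, IsCompact K → K ⊆ D.carrier → ∀ N : ℕ, ∀ᶠ δ in 𝓝[>] (0:ℝ), ∀ v : Site 2,
        meshPoint δ v ∈ K → N ≤ depth (Λ δ) v)
    (hP : EdgePrecompact) : EdgeCoherence :=
  edgeCoherence_of_blockPresentation hne φ depth traj hθ0 hθ1 hσ hB hCCC hφ hpres hdepth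
    fun D Λ hΩ hmesh hadm K hK hKD => ((hP D Λ hΩ hmesh hadm) K hK hKD).1

end Glue

end Summit.CriticalPhenomena.CardyFormulaZ2.Theorems.MarkovBlockPresentation
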